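import Mathlib
import HarnessLib
import Summits.HubbardSuperconductivity.HubbardSuperconductivity.Theorems.KLProgrammeKLRegimeEnginePairTransferMemberPHSignedRow

/-!
# Route `KLProgramme` — ENGINE item stmt-HubbardSuperconductivity-20437 `KLRegimeEngineV17F2`, class-#5 STEP (X).3 rows form (row `hS` of
# `klmd_defect_le_rows_family`, the BORN class `RS`): THE SIGNED BORN ROW — the zero-transfer forward bubble `Σ_p Σ_σ Ẇ(p)G(p)·Φ_j(t)(p)G(p)·V6(p)·Σ(p)`
# with the kernel product split into its frequency-pinned part and a flat remainder, then the model row at transfer `0`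
# (cell gate-hubbard-kl, seat hubbard-kl-k3c2-p2 g17, technique «thermal-bar induction n ≤ nScales β + 1»)

Same recipe as `…MemberPHSigned(Row)` for the direct class, simpler (both lines at the SAME label, no partner sum, no re-indexing):

* **`klms_memberBorn_norm_le`** — for ANY `V6`, `Sg` and ANY `ε` bounding the loop-frequency variation of `X(p,σ) = V6(p σ 0, p σ 1, y, Q−y, Q−x, x)·Σ(p,σ)` on the
  window `ω² ≤ (4Λₙ₊₁)²`: `‖S_S‖ ≤ |βL²|²·‖Σ_p Y(k̃)·Φ_Ẇ(ω_p, e_K k̃)·Φ_{Φ_j}(ω_p, e_K k̃)‖ + ε·(256/3)(βL²)²/Λ(t)²·Σ_p|Φ_j(t)(p)|‖ĝ_K p‖`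
  (`Y(k̃) = Σ_σ X((ω₀,k̃),σ)`; flat part by `born_mass_le_softSum`);
* **`klms_memberBorn_signed_le`** — with lattice data `‖Y‖ ≤ A₀`, torus-Lipschitz `L_A`: `‖S_S‖ ≤ (βL²)²·βL²·klmsRowBound … (G·|p_0|_𝕋) L + ε·flat`
  (`klms_pinned_bubble_norm_le` at `q̃ = 0`; `klTorusNorm L 0 = 0` makes the transfer slot vanish, `klTorusNorm_zero`).

Pure composition; nothing about the model's effective action is asserted; nothing asserts (X).3, (c), K3 or superconductivity.
-/

noncomputable section

namespace Summit.HubbardSuperconductivity.HubbardSuperconductivity.Theorems.KLRegimeSplit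

set_option linter.dupNamespace false -- summit = problem name (single-conjunct summit), D-0017

open Real Set Finset Complex Literature.MathematicalPhysics.QuantumLattice
open Literature.Probability.LatticeModels hiding torusSupNorm
open Literature.MathematicalPhysics.QuantumLattice.BandSectorCounting
open Summit.HubbardSuperconductivity.HubbardSuperconductivity.Theorems.KLProgrammeLegKernels
open Summit.HubbardSuperconductivity.HubbardSuperconductivity.Theorems.KLRegimeWick
open Summit.HubbardSuperconductivity.HubbardSuperconductivity.Theorems.TwoPointAssembly
open Summit.HubbardSuperconductivity.HubbardSuperconductivity.Theorems.DispersionFlow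
open Summit.HubbardSuperconductivity.HubbardSuperconductivity.Theorems.PerturbedFermiCurve

variable {L M : ℕ} [NeZero L] [NeZero M] (β μ : ℝ) (K : TrigPolyC4v)

/-- **THE BORN ROW `hS`, KERNEL PRODUCT SPLIT.** -/
theorem klms_memberBorn_norm_le (hβ : 0 < β) (n : ℕ) {t : ℝ} (ht : t ∈ Icc (0 : ℝ) 1)
    (Φ : ℕ → ℝ → FreqMomentum L M → ℝ) (hΦ : Φ = fun j t k => (softSymbolCompl L M β μ K (n + 1) j) k + (hubbardCutoffWeightCT L M β μ K (klScale klE0 (n + 1)) k -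
            hubbardCutoffWeightCT L M β μ K (klScale klE0 n + t * (klScale klE0 (n + 1) - klScale klE0 n)) k))
    (Wd : ℝ → FreqMomentum L M → ℝ) (hWd : Wd = fun t k => deriv (fun Λ' : ℝ => hubbardCutoffWeightCT L M β μ K Λ' k) (klScale klE0 n + t * (klScale klE0 (n + 1) - klScale klE0 n)))
    (V6 : ℕ → ℝ → (Fin 6 → HubbardFieldIdx L M) → ℂ) (Sg : ℕ → ℝ → FreqMomentum L M → Fin 2 → ℂ) (j : ℕ) (Qm x y : TorusSite 2 L) {ε : ℝ} (hε : 0 ≤ ε)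
    (hflat : ∀ (i : MatsubaraIdx M) (σ : Fin 2) (k : TorusSite 2 L), matsubaraFreq β M i ^ 2 ≤ (4 * klScale klE0 (n + 1)) ^ 2 →
      ‖V6 j t ![(((i, k), σ), 0), (((i, k), σ), 1), (((omega0 M, y), 0), 0), ((((omega0 M).rev, Qm - y), 1), 0), ((((omega0 M).rev, Qm - x), 1), 1),
              (((omega0 M, x), 0), 1)] * Sg j t (i, k) σ -
          V6 j t ![(((omega0 M, k), σ), 0), (((omega0 M, k), σ), 1), (((omega0 M, y), 0), 0), ((((omega0 M).rev, Qm - y), 1), 0), ((((omega0 M).rev, Qm - x), 1), 1),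
              (((omega0 M, x), 0), 1)] * Sg j t (omega0 M, k) σ‖ ≤ ε) :
    ‖∑ p : FreqMomentum L M, ∑ σ : Fin 2,
        (((((Wd t p) : ℝ) : ℂ) * (((β * (L : ℝ) ^ 2 : ℝ) : ℂ) * propCT L M β μ K p)) * ((((Φ j t p) : ℝ) : ℂ) * (((β * (L : ℝ) ^ 2 : ℝ) : ℂ) * propCT L M β μ K p))) *
          (V6 j t ![((p, σ), 0), ((p, σ), 1), (((omega0 M, y), 0), 0), ((((omega0 M).rev, Qm - y), 1), 0), ((((omega0 M).rev, Qm - x), 1), 1),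
              (((omega0 M, x), 0), 1)] * Sg j t p σ)‖ ≤
      (β * (L : ℝ) ^ 2) ^ 2 *
          ‖∑ p : FreqMomentum L M,
              (∑ σ : Fin 2, V6 j t ![(((omega0 M, p.2), σ), 0), (((omega0 M, p.2), σ), 1), (((omega0 M, y), 0), 0), ((((omega0 M).rev, Qm - y), 1), 0),
                  ((((omega0 M).rev, Qm - x), 1), 1), (((omega0 M, x), 0), 1)] * Sg j t (omega0 M, p.2) σ) *
                (klfb_prop (klWdC (klScale klE0 n + t * (klScale klE0 (n + 1) - klScale klE0 n))) (matsubaraFreq β M p.1) (nambuXiCT L μ K p.2) *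
                  klfb_prop (klPhiC (klScale klE0 j) (klScale klE0 n + t * (klScale klE0 (n + 1) - klScale klE0 n))) (matsubaraFreq β M p.1)
                    (nambuXiCT L μ K (p.2 + 0)))‖ +
        ε * (256 / 3 * (β * (L : ℝ) ^ 2) ^ 2 / (klScale klE0 n + t * (klScale klE0 (n + 1) - klScale klE0 n)) ^ 2 *
          ∑ p : FreqMomentum L M, |Φ j t p| * ‖propCT L M β μ K p‖) := by
  set Λt : ℝ := klScale klE0 n + t * (klScale klE0 (n + 1) - klScale klE0 n) with hΛt
  obtain ⟨hlo, hhi⟩ := scaleAt_mem n ht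
  have hΛpos : 0 < Λt := (klth_klScale_pos (n + 1)).trans_le hlo
  set X : FreqMomentum L M → Fin 2 → ℂ := fun p σ =>
    V6 j t ![((p, σ), 0), ((p, σ), 1), (((omega0 M, y), 0), 0), ((((omega0 M).rev, Qm - y), 1), 0), ((((omega0 M).rev, Qm - x), 1), 1), (((omega0 M, x), 0), 1)] *
      Sg j t p σ with hX
  set X₀ : FreqMomentum L M → Fin 2 → ℂ := fun p σ =>
    V6 j t ![(((omega0 M, p.2), σ), 0), (((omega0 M, p.2), σ), 1), (((omega0 M, y), 0), 0), ((((omega0 M).rev, Qm - y), 1), 0),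
        ((((omega0 M).rev, Qm - x), 1), 1), (((omega0 M, x), 0), 1)] * Sg j t (omega0 M, p.2) σ with hX₀
  set G : FreqMomentum L M → ℂ := fun p => (((β * (L : ℝ) ^ 2 : ℝ)) : ℂ) * propCT L M β μ K p with hG
  set ln : FreqMomentum L M → ℂ := fun p => (((Wd t p : ℝ)) : ℂ) * G p * ((((Φ j t p : ℝ)) : ℂ) * G p) with hln
  have hsplit : (∑ p : FreqMomentum L M, ∑ σ : Fin 2,
        (((((Wd t p) : ℝ) : ℂ) * (((β * (L : ℝ) ^ 2 : ℝ) : ℂ) * propCT L M β μ K p)) * ((((Φ j t p) : ℝ) : ℂ) * (((β * (L : ℝ) ^ 2 : ℝ) : ℂ) * propCT L M β μ K p))) *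
          (V6 j t ![((p, σ), 0), ((p, σ), 1), (((omega0 M, y), 0), 0), ((((omega0 M).rev, Qm - y), 1), 0), ((((omega0 M).rev, Qm - x), 1), 1),
              (((omega0 M, x), 0), 1)] * Sg j t p σ)) =
      (∑ p : FreqMomentum L M, ln p * ∑ σ : Fin 2, X₀ p σ) + ∑ p : FreqMomentum L M, ∑ σ : Fin 2, ln p * (X p σ - X₀ p σ) := by
    rw [← Finset.sum_add_distrib]
    refine Finset.sum_congr rfl fun p _ => ?_
    rw [Finset.mul_sum, ← Finset.sum_add_distrib]
    refine Finset.sum_congr rfl fun σ _ => ?_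
    simp only [hln, hX, hX₀, hG]; ring
  rw [hsplit]
  refine (norm_add_le _ _).trans (add_le_add ?_ ?_)
  · -- the pinned part: the model lines at the same label
    subst hΦ hWd
    have hlines : ∀ p : FreqMomentum L M, ln p = (((β * (L : ℝ) ^ 2 : ℝ)) : ℂ) ^ 2 *
        (klfb_prop (klWdC Λt) (matsubaraFreq β M p.1) (nambuXiCT L μ K p.2) * klfb_prop (klPhiC (klScale klE0 j) Λt) (matsubaraFreq β M p.1) (nambuXiCT L μ K (p.2 + 0))) := by
      intro p
      have h := klrf_lines_eq μ K hβ.ne' n j hΛpos.ne' p (p.2 + 0)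
      have hp : ((p.1, p.2 + 0) : FreqMomentum L M) = p := by ext <;> simp
      rw [hp] at h
      simpa only [hln, hG] using h
    have e : (∑ p : FreqMomentum L M, ln p * ∑ σ : Fin 2, X₀ p σ) = (((β * (L : ℝ) ^ 2 : ℝ)) : ℂ) ^ 2 * ∑ p : FreqMomentum L M,
        (∑ σ : Fin 2, X₀ p σ) * (klfb_prop (klWdC Λt) (matsubaraFreq β M p.1) (nambuXiCT L μ K p.2) *
          klfb_prop (klPhiC (klScale klE0 j) Λt) (matsubaraFreq β M p.1) (nambuXiCT L μ K (p.2 + 0))) := by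
      rw [Finset.mul_sum]; exact Finset.sum_congr rfl fun p _ => by rw [hlines]; ring
    rw [e, norm_mul, norm_pow, Complex.norm_real, Real.norm_of_nonneg (by positivity)]
  · -- the flat remainder
    have hterm : ∀ (p : FreqMomentum L M) (σ : Fin 2), ‖ln p * (X p σ - X₀ p σ)‖ ≤ ε * ‖ln p‖ := by
      intro p σ
      by_cases hwin : matsubaraFreq β M p.1 ^ 2 ≤ (4 * klScale klE0 (n + 1)) ^ 2
      · rw [norm_mul, mul_comm]
        refine mul_le_mul_of_nonneg_right ?_ (norm_nonneg _)
        have hp : p = (p.1, p.2) := rfl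
        have h := hflat p.1 σ p.2 hwin
        simp only [hX, hX₀]
        rw [hp]
        exact h
      · have hω' : (4 * klScale klE0 (n + 1)) ^ 2 < matsubaraFreq β M p.1 ^ 2 := not_le.mp hwin
        have hz : Wd t p = 0 := by simp only [hWd]; exact klms_Wd_eq_zero_of_freq β μ K n hlo hhi p hω'
        have hln0 : ln p = 0 := by simp only [hln, hz]; simp
        rw [hln0]
        simp
    calc ‖∑ p : FreqMomentum L M, ∑ σ : Fin 2, ln p * (X p σ - X₀ p σ)‖
        ≤ ∑ p : FreqMomentum L M, ∑ σ : Fin 2, ε * ‖ln p‖ :=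
          (norm_sum_le _ _).trans (Finset.sum_le_sum fun p _ => (norm_sum_le _ _).trans (Finset.sum_le_sum fun σ _ => hterm p σ))
      _ = ε * ∑ p : FreqMomentum L M, ∑ _σ : Fin 2, ‖ln p‖ := by simp only [Finset.mul_sum]
      _ ≤ ε * (256 / 3 * (β * (L : ℝ) ^ 2) ^ 2 / Λt ^ 2 * ∑ p : FreqMomentum L M, |Φ j t p| * ‖propCT L M β μ K p‖) := by
          refine mul_le_mul_of_nonneg_left ?_ hε
          have h := born_mass_le_softSum β μ K hβ hΛpos (Φ j t)
          subst hWd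
          simpa only [hln, hG] using h

section Model

variable {a' b' : ℝ} (B : BandBounds a' b') {R : RenConsts} {U : ℝ} {N : ℕ} {A : ℝ}

/-- **THE SIGNED BORN ROW, ASSEMBLED**: `‖S_S‖ ≤ (βL²)²·(βL²·klmsRowBound … (G·|p_0|_𝕋) L) + ε·(256/3)(βL²)²/Λ(t)²·Σ_p|Φ_j(t)(p)|‖ĝ_K p‖`. -/
theorem klms_memberBorn_signed_le (hR : ∀ j, 0 ≤ R.Gfr j) (hK : FrameOK R U N μ K)
    (hAb : ∀ p : Momentum, ∀ j ≤ 2, ‖iteratedFDeriv ℝ j (frameShift K) p‖ ≤ A) (hA : 4 * A < B.Dtmin) (hA20 : 4 * A ≤ 1 / 20) (hμ : μ ≤ -0.15)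
    (n : ℕ) {t : ℝ} (ht : t ∈ Icc (0 : ℝ) 1) (hβ : klBetaMin ≤ β) (hn : n + 1 ≤ nScales β + 1)
    (hM : β * (4 * klScale klE0 (n + 1)) / (2 * Real.pi) + 1 ≤ M)
    (Φ : ℕ → ℝ → FreqMomentum L M → ℝ) (hΦ : Φ = fun j t k => (softSymbolCompl L M β μ K (n + 1) j) k + (hubbardCutoffWeightCT L M β μ K (klScale klE0 (n + 1)) k -
            hubbardCutoffWeightCT L M β μ K (klScale klE0 n + t * (klScale klE0 (n + 1) - klScale klE0 n)) k))
    (Wd : ℝ → FreqMomentum L M → ℝ) (hWd : Wd = fun t k => deriv (fun Λ' : ℝ => hubbardCutoffWeightCT L M β μ K Λ' k) (klScale klE0 n + t * (klScale klE0 (n + 1) - klScale klE0 n)))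
    (V6 : ℕ → ℝ → (Fin 6 → HubbardFieldIdx L M) → ℂ) (Sg : ℕ → ℝ → FreqMomentum L M → Fin 2 → ℂ) {j : ℕ} (hj : n + 1 ≤ j) (Qm x y : TorusSite 2 L)
    (hlo : a' < μ - 4 * klScale klE0 (n + 1) - 4 * A) (hhi : μ + 4 * klScale klE0 (n + 1) + 4 * A < b')
    {A₀ LA ε : ℝ} (hA0 : 0 ≤ A₀) (hLA : 0 ≤ LA) (hε : 0 ≤ ε)
    (hY0 : ∀ k : TorusSite 2 L, ‖∑ σ : Fin 2, V6 j t ![(((omega0 M, k), σ), 0), (((omega0 M, k), σ), 1), (((omega0 M, y), 0), 0), ((((omega0 M).rev, Qm - y), 1), 0),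
        ((((omega0 M).rev, Qm - x), 1), 1), (((omega0 M, x), 0), 1)] * Sg j t (omega0 M, k) σ‖ ≤ A₀)
    (hY1 : ∀ k k' : TorusSite 2 L, ‖(∑ σ : Fin 2, V6 j t ![(((omega0 M, k), σ), 0), (((omega0 M, k), σ), 1), (((omega0 M, y), 0), 0), ((((omega0 M).rev, Qm - y), 1), 0),
          ((((omega0 M).rev, Qm - x), 1), 1), (((omega0 M, x), 0), 1)] * Sg j t (omega0 M, k) σ) -
        ∑ σ : Fin 2, V6 j t ![(((omega0 M, k'), σ), 0), (((omega0 M, k'), σ), 1), (((omega0 M, y), 0), 0), ((((omega0 M).rev, Qm - y), 1), 0),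
          ((((omega0 M).rev, Qm - x), 1), 1), (((omega0 M, x), 0), 1)] * Sg j t (omega0 M, k') σ‖ ≤ LA * klTorusNorm L (k - k'))
    (hflat : ∀ (i : MatsubaraIdx M) (σ : Fin 2) (k : TorusSite 2 L), matsubaraFreq β M i ^ 2 ≤ (4 * klScale klE0 (n + 1)) ^ 2 →
      ‖V6 j t ![(((i, k), σ), 0), (((i, k), σ), 1), (((omega0 M, y), 0), 0), ((((omega0 M).rev, Qm - y), 1), 0), ((((omega0 M).rev, Qm - x), 1), 1),
              (((omega0 M, x), 0), 1)] * Sg j t (i, k) σ -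
          V6 j t ![(((omega0 M, k), σ), 0), (((omega0 M, k), σ), 1), (((omega0 M, y), 0), 0), ((((omega0 M).rev, Qm - y), 1), 0), ((((omega0 M).rev, Qm - x), 1), 1),
              (((omega0 M, x), 0), 1)] * Sg j t (omega0 M, k) σ‖ ≤ ε) :
    ‖∑ p : FreqMomentum L M, ∑ σ : Fin 2,
        (((((Wd t p) : ℝ) : ℂ) * (((β * (L : ℝ) ^ 2 : ℝ) : ℂ) * propCT L M β μ K p)) * ((((Φ j t p) : ℝ) : ℂ) * (((β * (L : ℝ) ^ 2 : ℝ) : ℂ) * propCT L M β μ K p))) *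
          (V6 j t ![((p, σ), 0), ((p, σ), 1), (((omega0 M, y), 0), 0), ((((omega0 M).rev, Qm - y), 1), 0), ((((omega0 M).rev, Qm - x), 1), 1),
              (((omega0 M, x), 0), 1)] * Sg j t p σ)‖ ≤
      (β * (L : ℝ) ^ 2) ^ 2 *
          (β * (L : ℝ) ^ 2 * klmsRowBound B.Dtmin A (4 + 8 / 3 * R.Gfr 1 * U ^ 2) A₀ LA β n j ((4 + 8 / 3 * R.Gfr 1 * U ^ 2) * klTorusNorm L (0 : TorusSite 2 L)) L) +
        ε * (256 / 3 * (β * (L : ℝ) ^ 2) ^ 2 / (klScale klE0 n + t * (klScale klE0 (n + 1) - klScale klE0 n)) ^ 2 *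
          ∑ p : FreqMomentum L M, |Φ j t p| * ‖propCT L M β μ K p‖) := by
  have hβ0 : 0 < β := lt_of_lt_of_le (by norm_num [klBetaMin]) hβ
  have h0 := klms_memberBorn_norm_le β μ K hβ0 n ht Φ hΦ Wd hWd V6 Sg j Qm x y hε hflat
  have hq : (4 + 8 / 3 * R.Gfr 1 * U ^ 2) * klTorusNorm L (0 : TorusSite 2 L) ≤ klScale klE0 (n + 1) / 8 := by
    rw [klTorusNorm_zero, mul_zero]; exact div_nonneg (klth_klScale_pos (n + 1)).le (by norm_num)
  have h1 := klms_pinned_bubble_norm_le B hR hK hAb hA hA20 hμ n ht hj hlo hhi hβ hn hM (0 : TorusSite 2 L) hq hA0 hLA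
    (Y := fun k : TorusSite 2 L => ∑ σ : Fin 2, V6 j t ![(((omega0 M, k), σ), 0), (((omega0 M, k), σ), 1), (((omega0 M, y), 0), 0),
      ((((omega0 M).rev, Qm - y), 1), 0), ((((omega0 M).rev, Qm - x), 1), 1), (((omega0 M, x), 0), 1)] * Sg j t (omega0 M, k) σ)
    hY0 hY1
  exact h0.trans (add_le_add (mul_le_mul_of_nonneg_left h1 (by positivity)) le_rfl)

end Model

end Summit.HubbardSuperconductivity.HubbardSuperconductivity.Theorems.KLRegimeSplit

end
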